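import Summits.AtomisticToContinuum.Crystallization.Theses.ThreeConeCertificate

/-!
# Transfer exhibit for crux stmt-AtomisticToContinuum-11959 `ExactCertificate`: the d = 1 analogue is EXACTLY solvable

Crux-strategist (wall-breaker) `planner-cstrat-stmt-AtomisticToContinuum-11959-p1-0`, 2026-08-17.  Companion of
`STRATEGY-CENSUS.md` §2a / Appendix A (same directory).  This file TYPES the one-dimensional exact certificate; the two analytic
inputs (`Psi_posType`, `gCore_nonneg`) and the lattice-sum bookkeeping are left as `sorry` — they are numerically certified in the
census (pure-python scripts attached to the item) and are a self-contained target for any idle prover.  Nothing here is a stub of a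
line for the 3-D crux: the point of the exhibit is WHERE the construction breaks in d = 3 (no finite-range radial invisibility operator).

The construction (`V = lennardJones`, `a = a⋆ = (ζ(12)/ζ(6))^{1/6} = π·(691/675675)^{1/6} ≈ 0.99718`, zero pressure `Σ_{j≥1} j V′(ja) = 0`):

  Ψ(x) := −4 Σ_{j≥1} j·V(|x| + j a)      (retarded Green's function of the second difference Δ_a applied to V, even extension)
  F(x) := −¼ (Ψ(x+a) − 2Ψ(x) + Ψ(x−a))    (Fourier side: F̂(ξ) = sin²(πaξ)·Ψ̂(ξ) — invisible to aℤ)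
  g(r) := (V(r) − F(r))·1_{(0,a)}(r),  U :≡ 0,  c := 0,  ρ := a,  P := aℤ.

Facts: `F = V` on `[a,∞)` identically (`Δ_a Σ_j jW(·+ja) = W`); `F(0) = ½(Ψ(0) − Ψ(a)) = −2·e(aℤ)`; `Ψ′(0) = 0` IS the zero-pressure
condition (tangency of `F` and `V` at the first shell); `g(a−t) = (Ψ‴(0⁺)/12)t³ + O(t⁴)`, `Ψ‴(0⁺) = −4Σ jV‴(ja) ≈ +528.85`, `g > 0` on
`(0,a)`; `Ψ̂ > 0` (decreasing from `0.2301` to the asymptote `2Ψ‴(0⁺)/(2πξ)⁴`).  Hence `V = g + U + F` with `g ≥ 0` of range `a`, `F` of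
positive type, `c + F(0)/2 = −e(aℤ)`: the d = 1 `ExactCertificate`, with `ρ` = minimal distance and `c = 0` (a SHARP two-cone Fisher–Ruelle
split), and in two lines `E_N(x) ≥ N·e(a⋆ℤ)` for every `N`.
-/

noncomputable section

namespace Summit.AtomisticToContinuum.Crystallization.Cruxes.ExactCertificate.Transfer1D

open Literature.MathematicalPhysics.StatisticalMechanics
open scoped BigOperators

/-- The d = 1 analogue of `ThreeConeCertificate.ExactCertificate`: the crux with `3 ↦ 1`, verbatim otherwise. -/
def ExactCertificate1D : Prop :=
  ∃ (P : PeriodicConfiguration 1) (ρ c : ℝ) (g U f : ℝ → ℝ),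
    (∀ r : ℝ, 0 < r → lennardJones r = g r + U r + f r) ∧ (∀ r : ℝ, 0 < r → 0 ≤ U r) ∧
    (∀ r : ℝ, ρ ≤ r → g r = 0) ∧
    (∀ (n : ℕ) (y : Fin n → EuclideanSpace ℝ (Fin 1)) (w : Fin n → ℝ),
      0 ≤ ∑ i, ∑ j, w i * w j * f (dist (y i) (y j))) ∧
    (∀ (N : ℕ) (x : Fin N → EuclideanSpace ℝ (Fin 1)), Function.Injective x →
      -(c * (N : ℝ)) ≤ interactionEnergy g x) ∧
    c + f 0 / 2 = -(P.energyPerParticle lennardJones)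

/-- The zero-pressure lattice constant `a⋆ = (ζ(12)/ζ(6))^{1/6} = π·(691/675675)^{1/6}`
(`ζ(6) = π⁶/945`, `ζ(12) = 691π¹²/638512875`, `638512875 = 945·675675`). -/
def aStar : ℝ := Real.pi * ((691 : ℝ) / 675675) ^ ((1 : ℝ) / 6)

theorem aStar_pos : 0 < aStar := by
  unfold aStar
  exact mul_pos Real.pi_pos (Real.rpow_pos_of_pos (by norm_num) _)

/-- `Ψ(x) = −4 Σ_{j ≥ 1} j·V(|x| + j a⋆)` (index `j = k + 1`). -/
def Psi (x : ℝ) : ℝ :=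
  -4 * ∑' k : ℕ, ((k : ℝ) + 1) * lennardJones (|x| + ((k : ℝ) + 1) * aStar)

/-- `F = −¼ Δ_{a⋆} Ψ`. -/
def F (x : ℝ) : ℝ := -(1 / 4) * (Psi (x + aStar) - 2 * Psi x + Psi (x - aStar))

/-- The finite-range remainder `g = (V − F)·1_{(0,a⋆)}` (range `ρ = a⋆`, the minimal distance of the template). -/
def gCore (r : ℝ) : ℝ := if r < aStar then lennardJones r - F r else 0

/-- KEY IDENTITY (algebra of the retarded Green's function): `F = V` on `[a⋆, ∞)` — `U ≡ 0`, the far field is paid by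
Bochner alone.  Proof on paper: for `r ≥ a⋆` all three stencil points are `≥ 0`, where `Ψ` is the series, and
`Σ_j j[W(r+(j+1)a) − 2W(r+ja) + W(r+(j−1)a)] = W(r)` termwise after reindexing (absolutely convergent: `V = O(r⁻⁶)`). -/
theorem F_eq_lennardJones {r : ℝ} (hr : aStar ≤ r) : F r = lennardJones r := by
  sorry

/-- ZERO PRESSURE ⇔ SMOOTHNESS: `Ψ` is differentiable at `0` with `Ψ′(0) = 0` because `Σ_{j≥1} j V′(j a⋆) = 0`
(the defining property of `a⋆`); recorded as the value identity `F 0 = ½(Ψ 0 − Ψ a⋆)`, which is definitional. -/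
theorem F_zero : F 0 = (Psi 0 - Psi aStar) / 2 := by
  have h : Psi (0 - aStar) = Psi aStar := by simp [Psi, abs_neg]
  simp only [F, zero_add, h]
  ring

/-- ANALYTIC INPUT 1 (numerically certified, census Appendix A: `Ψ̂(ξ) > 0`, min over `[0,12]` at the right end, certified asymptote
`2Ψ‴(0⁺)/(2πξ)⁴` beyond): `F` is of positive type on `ℝ¹` in the crux's finite-Gram sense (⇐ `F̂ = sin²(π a⋆ ξ) Ψ̂ ≥ 0`, `F ∈ C ∩ L¹`). -/
theorem F_posType (n : ℕ) (y : Fin n → EuclideanSpace ℝ (Fin 1)) (w : Fin n → ℝ) :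
    0 ≤ ∑ i, ∑ j, w i * w j * F (dist (y i) (y j)) := by
  sorry

/-- ANALYTIC INPUT 2 (numerically certified, census Appendix A; exact cubic contact `g(a⋆−t) = (Ψ‴(0⁺)/12)t³ + O(t⁴)`,
`Ψ‴(0⁺) ≈ 528.85 > 0`, `g → +∞` at `0⁺`): the remainder is non-negative, hence trivially `0`-stable. -/
theorem gCore_nonneg {r : ℝ} (hr : 0 < r) : 0 ≤ gCore r := by
  sorry

/-- `0`-stability of the remainder (from `gCore_nonneg`, pair by pair). -/
theorem gCore_stable (N : ℕ) (x : Fin N → EuclideanSpace ℝ (Fin 1)) (hx : Function.Injective x) :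
    -((0 : ℝ) * (N : ℝ)) ≤ interactionEnergy gCore x := by
  rw [zero_mul, neg_zero]
  unfold interactionEnergy
  refine Finset.sum_nonneg fun i _ => Finset.sum_nonneg fun j hj => gCore_nonneg ?_
  exact dist_pos.2 fun heq => (Finset.mem_Ioi.1 hj).ne' (hx heq.symm)

/-- BOOKKEEPING (lattice sums; on paper `F 0 = ½(Ψ 0 − Ψ a⋆) = −2 Σ_{n≥1} V(n a⋆) = −2 e(a⋆ℤ)`): there is a periodic configuration
of `ℝ¹` (the chain `a⋆ℤ`, motif `{0}`) whose Lennard-Jones energy per particle is `−F(0)/2`. -/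
theorem exists_chain_energy : ∃ P : PeriodicConfiguration 1, P.energyPerParticle lennardJones = -(F 0 / 2) := by
  sorry

/-- THE d = 1 EXACT CERTIFICATE, assembled from the inputs above (this composition is sorry-free):
`ρ = a⋆`, `c = 0`, `g = gCore`, `U = 0`, `f = F`. -/
theorem exactCertificate1D : ExactCertificate1D := by
  obtain ⟨P, hP⟩ := exists_chain_energy
  refine ⟨P, aStar, 0, gCore, fun _ => 0, F, ?_, fun _ _ => le_rfl, ?_, F_posType, gCore_stable, ?_⟩
  · intro r _
    by_cases h : r < aStar
    · simp [gCore, h]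
    · rw [gCore, if_neg h, F_eq_lennardJones (not_lt.1 h)]
      ring
  · intro r hr
    rw [gCore, if_neg (not_lt.2 hr)]
  · rw [hP]
    ring

/-- Consequence in two lines (the 1-D Kepler bound with the SHARP constant): `N·e(a⋆ℤ) ≤ E_N(x)` for every configuration of
`N` distinct points on a line — `E = E_g + E_F ≥ 0 − N F(0)/2`. -/
theorem keplerBound1D : ∃ P : PeriodicConfiguration 1, ∀ (N : ℕ) (x : Fin N → EuclideanSpace ℝ (Fin 1)),
    Function.Injective x → (N : ℝ) * P.energyPerParticle lennardJones ≤ interactionEnergy lennardJones x := by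
  obtain ⟨P, hP⟩ := exists_chain_energy
  refine ⟨P, fun N x hx => ?_⟩
  -- three-cone bound specialised: E_V = E_g + E_U + E_F with E_g ≥ 0, E_U = 0, E_F ≥ −N F 0 / 2
  have hsplit : interactionEnergy lennardJones x =
      interactionEnergy gCore x + interactionEnergy F x := by
    unfold interactionEnergy
    rw [← Finset.sum_add_distrib]
    refine Finset.sum_congr rfl fun i _ => ?_
    rw [← Finset.sum_add_distrib]
    refine Finset.sum_congr rfl fun j hj => ?_
    have hd : 0 < dist (x i) (x j) := dist_pos.2 fun heq => (Finset.mem_Ioi.1 hj).ne' (hx heq.symm)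
    by_cases h : dist (x i) (x j) < aStar
    · simp [gCore, h]
    · rw [gCore, if_neg h, F_eq_lennardJones (not_lt.1 h)]
      ring
  have hg : 0 ≤ interactionEnergy gCore x := by
    have := gCore_stable N x hx
    simpa using this
  -- Bochner with unit weights: Σᵢⱼ F(d_ij) = N F 0 + 2 E_F ≥ 0
  have hF : -((N : ℝ) * F 0 / 2) ≤ interactionEnergy F x := by
    have h1 := F_posType N x (fun _ => 1)
    simp only [one_mul] at h1
    have h2 : ∑ i, ∑ j, F (dist (x i) (x j)) = N * F 0 + 2 * interactionEnergy F x := by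
      rw [two_mul_interactionEnergy]
      have h : ∀ i : Fin N, ∑ j, F (dist (x i) (x j)) = F 0 + siteEnergy F x i := fun i => by
        rw [siteEnergy, ← Finset.add_sum_erase Finset.univ _ (Finset.mem_univ i), dist_self]
      simp only [h, Finset.sum_add_distrib, Finset.sum_const, Finset.card_univ, Fintype.card_fin,
        nsmul_eq_mul]
    rw [h2] at h1
    linarith
  rw [hP, hsplit]
  nlinarith [hg, hF]

end Summit.AtomisticToContinuum.Crystallization.Cruxes.ExactCertificate.Transfer1D

end
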